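import Summits.MatrixMultiplication.MatrixMultiplication.Theorems.SoloBlindFrameCertificate

/-!
# Solo-blind seat (MatrixMultiplication), s71 — the BOX-ISOLATION certificate (paper/KraftK3.md §7.12, DATA K3.12.8; CLAIMS c712)

Context (door I1⁗ / Kraft inequality (K₃) / Conjecture G, see `SoloBlindFrameCertificate`): a level set `A ⊆ 𝔽₃ⁿ` is GOOD in a frame
`y = W x` when the `2ⁿ` multilinear monomials in `y` span all functions on `A`; GOOD ⟹ `|A| ≤ 2ⁿ` (`frameCertificate_card_le`).
In the kernel-certified good frames of the tight sets the multilinear SEPARATORS turn out to be sparse products, and a completely split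
separator `∏ i, (y i - c i)` exists for a point `a` exactly when `a` is BOX-ISOLATED: some `c` with `c i ≠ y i a` for every `i` agrees with
every other point of `A` in at least one coordinate.

This file proves the resulting purely combinatorial certificate in full generality — any field `K`, any coordinate functions
`y i : α → K` (no linearity, no alphabet bound): if every point of `A` is box-isolated then the multilinear evaluation vectors of the points
of `A` are linearly independent (`iso_linearIndependent`, via the split separators and the expansion `∏ (y i b - c i) = ∑_T (∏_{i∈T} y i b)·∏_{i∉T} (−c i)`),
hence `|A| ≤ 2ⁿ` (`iso_card_le`; the `𝔽₃`-frame instance is `isoFrame_card_le`).  As a concrete instance, the twisted tight set `T₂`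
(level `(1,1,0)` of `(x₁², x₂², x₃²+x₄²+x₁x₂)`, 16 points) is box-isolated in the frame `y = (x₄, x₃+x₄, x₂, x₁)` (`t2_iso`, by `decide`),
which re-proves `|T₂| ≤ 16` through the certificate (`t2_card_le_of_iso`).  Exhaustively, `T₂` has 1636 and `T5a` has 364 ISO frames —
the BOX-frame counts of §7.11 — and the generic tight set at `n = 6` has none among 3·10⁶ random frames: ISO is the combinatorial shadow of Φ,
not Φ itself.  Pure linear algebra / finite check; no `ω` content.
-/

set_option linter.dupNamespace false
set_option autoImplicit false

namespace Summit.MatrixMultiplication.MatrixMultiplication.Theorems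

open Finset

/-- Box-isolation of a finite set `A` with respect to coordinate functions `y i : α → K`: every `a ∈ A` has an "antipode" `c`
(differing from `a` in every coordinate) that meets every other point of `A` in some coordinate. -/
abbrev BoxIsolated {n : ℕ} {α K : Type*} (y : Fin n → α → K) (A : Finset α) : Prop :=
  ∀ a ∈ A, ∃ c : Fin n → K, (∀ i, y i a ≠ c i) ∧ ∀ b ∈ A, b ≠ a → ∃ i, y i b = c i

/-- Expansion of the split separator into multilinear monomials:
`∏ i, (y i b - c i) = ∑_T (∏_{i ∈ T} y i b) * ∏_{i ∉ T} (-c i)`. -/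
theorem prod_sub_eq_sum_multilinear {n : ℕ} {K : Type*} [CommRing K] (z c : Fin n → K) :
    ∏ i, (z i - c i) = ∑ T : Finset (Fin n), (∏ i ∈ T, z i) * ∏ i ∈ univ \ T, (-c i) := by
  have h := Finset.prod_add (fun i => z i) (fun i => -c i) (univ : Finset (Fin n))
  simp only [Finset.powerset_univ] at h
  simpa [sub_eq_add_neg] using h

/-- ISO ⟹ independence: if `A` is box-isolated for the coordinates `y`, the multilinear evaluation vectors
`T ↦ ∏_{i ∈ T} y i a`, `a ∈ A`, are linearly independent over the field `K` (the split separator `∏ i, (y i - c i)` of `a`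
is a linear functional killing every other evaluation vector and not that of `a`). -/
theorem iso_linearIndependent {n : ℕ} {α K : Type*} [Field K] (y : Fin n → α → K) (A : Finset α)
    (hiso : BoxIsolated y A) :
    LinearIndependent K (fun a : A => fun T : Finset (Fin n) => ∏ i ∈ T, y i (a : α)) := by
  rw [linearIndependent_iff']
  intro s g hg a ha
  obtain ⟨c, hca, hcb⟩ := hiso a a.2
  -- every coefficient functional of the relation vanishes
  have hT : ∀ T : Finset (Fin n), ∑ b ∈ s, g b * ∏ i ∈ T, y i (b : α) = 0 := by
    intro T
    have := congr_fun hg T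
    simpa [Finset.sum_apply, Pi.smul_apply, smul_eq_mul] using this
  -- pair the relation with the weights of the split separator of `a`
  have h2 : ∑ b ∈ s, g b * ∏ i, (y i (b : α) - c i) = 0 := by
    have hre : ∑ b ∈ s, g b * ∏ i, (y i (b : α) - c i)
        = ∑ T : Finset (Fin n), (∏ i ∈ univ \ T, (-c i)) * ∑ b ∈ s, g b * ∏ i ∈ T, y i (b : α) := by
      simp_rw [prod_sub_eq_sum_multilinear, Finset.mul_sum]
      rw [Finset.sum_comm]
      refine Finset.sum_congr rfl (fun T _ => Finset.sum_congr rfl (fun b _ => by ring))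
    rw [hre]
    simp [hT]
  -- only the term of `a` survives
  have h3 : ∑ b ∈ s, g b * ∏ i, (y i (b : α) - c i) = g a * ∏ i, (y i (a : α) - c i) := by
    apply Finset.sum_eq_single a
    · intro b _ hba
      obtain ⟨i, hi⟩ := hcb b b.2 (fun h => hba (Subtype.ext h))
      rw [Finset.prod_eq_zero (Finset.mem_univ i) (by rw [hi, sub_self]), mul_zero]
    · intro hna
      exact absurd ha hna
  have h4 : ∏ i, (y i (a : α) - c i) ≠ 0 :=
    Finset.prod_ne_zero_iff.mpr (fun i _ => sub_ne_zero.mpr (hca i))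
  rw [h3] at h2
  exact (mul_eq_zero.mp h2).resolve_right h4

/-- ISO ⟹ `|A| ≤ 2ⁿ`: a box-isolated set (any field, any coordinate functions) has at most `2ⁿ` points. -/
theorem iso_card_le {n : ℕ} {α K : Type*} [Field K] (y : Fin n → α → K) (A : Finset α)
    (hiso : BoxIsolated y A) : A.card ≤ 2 ^ n :=
  frameCertificate_card_le y A (iso_linearIndependent y A hiso)

/-- The `𝔽₃`-frame instance: if `A ⊆ 𝔽₃ⁿ` is box-isolated in the coordinates `y = W x` then `|A| ≤ 2ⁿ`. -/
theorem isoFrame_card_le (n : ℕ) (W : Matrix (Fin n) (Fin n) (ZMod 3)) (A : Finset (Fin n → ZMod 3))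
    (hiso : BoxIsolated (fun i (x : Fin n → ZMod 3) => (W.mulVec x) i) A) : A.card ≤ 2 ^ n := by
  haveI : Fact (Nat.Prime 3) := ⟨by norm_num⟩
  exact iso_card_le _ A hiso

/-- The twisted tight set `T₂ ⊆ 𝔽₃⁴`: level `(1,1,0)` of `(x₁², x₂², x₃² + x₄² + x₁x₂)` (as a decidable predicate). -/
abbrev IsT2pt (x : Fin 4 → ZMod 3) : Prop :=
  x 0 * x 0 = 1 ∧ x 1 * x 1 = 1 ∧ x 2 * x 2 + x 3 * x 3 + x 0 * x 1 = 0

/-- `T₂` as a `Finset`. -/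
def t2Set : Finset (Fin 4 → ZMod 3) := Finset.univ.filter IsT2pt

/-- `T₂` has 16 = 2⁴ points (it is tight). -/
theorem t2Set_card : t2Set.card = 16 := by decide +kernel

/-- The box frame of `T₂`: `y = (x₄, x₃ + x₄, x₂, x₁)`. -/
def t2IsoFrame : Matrix (Fin 4) (Fin 4) (ZMod 3) :=
  !![0, 0, 0, 1; 0, 0, 1, 1; 0, 1, 0, 0; 1, 0, 0, 0]

/-- `T₂` is BOX-ISOLATED in the frame `y = (x₄, x₃ + x₄, x₂, x₁)` (finite check). -/
theorem t2_iso : BoxIsolated (fun i (x : Fin 4 → ZMod 3) => (t2IsoFrame.mulVec x) i) t2Set := by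
  decide +kernel

/-- `|T₂| ≤ 2⁴` re-derived through the ISO certificate. -/
theorem t2_card_le_of_iso : t2Set.card ≤ 2 ^ 4 :=
  isoFrame_card_le 4 t2IsoFrame t2Set t2_iso

end Summit.MatrixMultiplication.MatrixMultiplication.Theorems
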